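import Literature.NumberTheory.EllipticCurves.FineSelmerRankEqualityRoad
import Literature.NumberTheory.EllipticCurves.ModFiveImageZywinaG9Exponent
import HarnessLib

/-!
# Statement (A) of Coates–Sujatha at `(E, 5)` for Zywina's image `G₉` (`5S4`) FROM THE LAYER-0 RANK EQUALITY
# `rank_5 Cl(ℚ(P)) = rank_5 Cl(ℚ(x(P)))` (degrees `24` and `12`)

Topic `NumberTheory/EllipticCurves` (grouping sub-namespace `CoatesSujatha2005.RankEqualityRoad`).  THEOREM-ONLY (no definition, no named fact, no
`sorry`); prover seat `bsd-potss-k8t-c4` g26 (cell `bsd-potss`, `--supports stmt-BirchSwinnertonDyer-19982`; closes nothing; neither BSD nor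
Conjecture A is booked for any curve).

`E/ℚ` with `Γ_ℚ` acting on `E[5]` in a basis `e` through Zywina's `G₉ ≤ GL₂(𝔽₅)` (`#G₉ = 96`, projective image `S₄`; the tree's `Zywina2015G9.G9` and
basis data `σ_u ↦ diag(1,2)`, `σ_w ↦ (0 4; 1 0)`).  `G₉` acts transitively on `E[5] ∖ 0` with `Stab(P) = ⟨diag(1,2)⟩` for `P = e⁻¹(1,0)`, so
`H = ⟨σ̄_u⟩` cuts out `ℚ(P)` (degree `24`) and `H′ = ⟨σ̄_w²⟩H` (`σ_w² = −1`) cuts out `ℚ(x(P))` (degree `12`) — the same field shapes as the `5Nn` road: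

* `not_five_dvd_card_gal_of_zywinaG9` — `5 ∤ #Gal(ℚ(E[5])/ℚ)` (exponent `24`, tree `coe_pow_twentyfour_eq_one_of_mem_G9`);
* `conjA_five_of_zywinaG9Basis_of_rankEq` — `#Cl(ℚ(P))[5] = #Cl(ℚ(x(P)))[5]` (`hrank`) and `σ̄_w² ∈ I(𝔮)` for every prime `𝔮 ∋ 5` of `ℚ(E[5])` (`hcI`,
  displayed: the finite criterion of `FineSelmerRankEqualityRoadInertia` FAILS for `G₉`, e.g. `diag(1,2)` has determinant `2` and no power `−1`)
  ⟹ statement (A) at `(E, 5)` for every cyclotomic `ℤ_5`-extension (`conjA_of_rankEq`, k8t-c4 g25, with `S = diag(1,2)`, `X = (0 4; 1 0)`).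
  NO classical-`μ` hypothesis (the `μ`-road door `fineSelmerDual_moduleFinite_of_zywinaG9Basis_five` displays six and the named fact CS05 Thm 3.4).

## References

* J. Coates, R. Sujatha, *Fine Selmer groups of elliptic curves over p-adic Lie extensions*, Math. Ann. 331 (2005), §3 Thm. 3.4, Lemma 3.8. [CoatesSujatha2005]
* K. Iwasawa, *A note on class numbers of algebraic number fields*, Abh. Math. Sem. Hamburg 20 (1956), §§3–5. [Iwasawa1956]
* D. Zywina, *On the possible images of the mod ℓ representations associated to elliptic curves over ℚ* (2015), §1.3 (`G₉`). [Zywina2015]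
* J.-P. Serre, *Propriétés galoisiennes des points d'ordre fini des courbes elliptiques*, Invent. Math. 15 (1972), §2.2. [Serre1972]
-/

set_option autoImplicit false

noncomputable section

open scoped Classical NumberField Matrix
open WeierstrassCurve Field IntermediateField
  Literature.NumberTheory.GaloisRepresentations Literature.NumberTheory.IwasawaTheory Literature.NumberTheory.NumberFields
  Literature.NumberTheory.EllipticCurves.Zywina2015G9

namespace Literature.NumberTheory.EllipticCurves.CoatesSujatha2005

namespace RankEqualityRoad

/-! ### §0 Helpers -/

/-- `(0 4; 1 0)² = −1` in `GL₂(𝔽₅)`. [folklore] -/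
private theorem w_sq_eq_neg_one₈ : (!![0, 4; 1, 0] : Matrix (Fin 2) (Fin 2) (ZMod 5)) * !![0, 4; 1, 0] = -1 := by decide

/-- Two matrices acting alike on all `e P` coincide (`e` onto). [folklore] -/
private theorem matrix_eq_of_forall_mulVec₈ {A : Type*} [AddCommGroup A] {n : ℕ} (e : A ≃+ (Fin 2 → ZMod n))
    {M N : Matrix (Fin 2) (Fin 2) (ZMod n)} (h : ∀ P : A, M *ᵥ e P = N *ᵥ e P) : M = N := by
  have h' : ∀ v, M *ᵥ v = N *ᵥ v := fun v => by simpa using h (e.symm v)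
  ext i j
  have := congrFun (h' (Pi.single j 1)) i
  simpa [Matrix.mulVec_single] using this

/-- Restriction `Γ_F → Gal(E/F)` is onto. [folklore] -/
private theorem absRestrictNormalHom_surjective₈ {F : Type} [Field F] (E : IntermediateField F (AlgebraicClosure F))
    [Normal F E] : Function.Surjective (absRestrictNormalHom E) := fun g => by
  obtain ⟨σ, hσ⟩ := AlgEquiv.restrictNormalHom_surjective (AlgebraicClosure F) g
  exact ⟨(Field.absoluteGaloisGroup.toAlgEquiv F).symm σ, hσ⟩

/-- `p ∤ #Gal(L/k)` when every element has order dividing `24` and `p ∤ 24`. [folklore] -/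
private theorem not_dvd_card_of_forall_pow_twentyfour₈ {k : Type} [Field k] (L : IntermediateField k (AlgebraicClosure k))
    [FiniteDimensional k L] {p : ℕ} (hp : p.Prime) (hp24 : ¬ p ∣ 24)
    (h24 : ∀ g : L ≃ₐ[k] L, g ^ 24 = 1) : ¬ p ∣ Nat.card (L ≃ₐ[k] L) := by
  classical
  haveI : Fact p.Prime := ⟨hp⟩
  intro h5
  rw [Nat.card_eq_fintype_card] at h5
  obtain ⟨g, hg⟩ := exists_prime_orderOf_dvd_card p h5
  have h1 : orderOf g ∣ 24 := orderOf_dvd_of_pow_eq_one (h24 g)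
  rw [hg] at h1
  exact hp24 h1

/-- **`5 ∤ #Gal(ℚ(E[5])/ℚ)` for an image in `G₉`** (every element of `G₉` has order dividing `24`). [cite: Zywina2015, §1.3] -/
theorem not_five_dvd_card_gal_of_zywinaG9 (W : WeierstrassCurve ℚ) [W.IsElliptic]
    (e : W.geomTorsion (5 : ℕ) ≃+ (Fin 2 → ZMod 5))
    (he : ∀ σ : absoluteGaloisGroup ℚ, ∃ M ∈ G9, ∀ P : W.geomTorsion (5 : ℕ),
      e (σ • P) = ((M : GL (Fin 2) (ZMod 5)) : Matrix (Fin 2) (Fin 2) (ZMod 5)) *ᵥ e P) :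
    ¬ 5 ∣ Nat.card (↥(W.divisionField 5) ≃ₐ[ℚ] ↥(W.divisionField 5)) := by
  classical
  haveI : Fact (Nat.Prime 5) := ⟨by norm_num⟩
  obtain ⟨ρm, hρm, hρme⟩ := exists_matrixRep_divisionField W 5 e
  have hmat : ∀ (σ : absoluteGaloisGroup ℚ) (M : Matrix (Fin 2) (Fin 2) (ZMod 5)),
      (∀ P, e (σ • P) = M *ᵥ e P) → ρm (absRestrictNormalHom _ σ) = M :=
    fun σ M hM => matrix_eq_of_forall_mulVec₈ e fun P => by rw [← hρme, hM]
  have hπ := absRestrictNormalHom_surjective₈ (W.divisionField 5)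
  refine not_dvd_card_of_forall_pow_twentyfour₈ (W.divisionField 5) (p := 5) (by norm_num) (by norm_num) fun g => hρm ?_
  obtain ⟨σ, rfl⟩ := hπ g
  obtain ⟨M, hM, hMe⟩ := he σ
  rw [map_pow, map_one, hmat σ _ hMe]
  exact coe_pow_twentyfour_eq_one_of_mem_G9 hM

/-! ### §1 Statement (A) at `(E, 5)` for a `G₉` image from the rank equality -/

/-- **(A) at `(E, 5)` for Zywina's `G₉` image FROM THE RANK EQUALITY — no `μ`-hypothesis, no named fact.**  `E/ℚ` elliptic with `Γ_ℚ` acting on `E[5]`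
through `G₉` in the basis `e` with `σ_u ↦ diag(1,2)`, `σ_w ↦ (0 4; 1 0)` (`σ_w² = −1`).  If `#Cl(ℚ(E[5])^⟨σ̄_u⟩)[5] = #Cl(ℚ(E[5])^⟨σ̄_w², σ̄_u⟩)[5]` (`hrank`:
`ℚ(P)` of degree `24` vs `ℚ(x(P))` of degree `12`) and `σ̄_w² ∈ I(𝔮)` for every prime `𝔮 ∋ 5` of `ℚ(E[5])` (`hcI`), then the dual fine Selmer group of `E`
over `ℚ_cyc` is finitely generated over `ℤ_5` for every cyclotomic `ℤ_5`-extension (`conjA_of_rankEq` with `S = diag(1,2)`, `X = (0 4; 1 0)`; (c1) by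
`not_five_dvd_card_gal_of_zywinaG9`). [cite: CoatesSujatha2005, §3 Thm. 3.4 and Lemma 3.8] [cite: Iwasawa1956, §§3–5] [cite: Zywina2015, §1.3] -/
theorem conjA_five_of_zywinaG9Basis_of_rankEq (W : WeierstrassCurve ℚ) [W.IsElliptic]
    (e : W.geomTorsion (5 : ℕ) ≃+ (Fin 2 → ZMod 5))
    (he : ∀ σ : absoluteGaloisGroup ℚ, ∃ M ∈ G9, ∀ P : W.geomTorsion (5 : ℕ),
      e (σ • P) = ((M : GL (Fin 2) (ZMod 5)) : Matrix (Fin 2) (Fin 2) (ZMod 5)) *ᵥ e P)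
    (σu σw : absoluteGaloisGroup ℚ) (hσu : ∀ P : W.geomTorsion (5 : ℕ), e (σu • P) = !![1, 0; 0, 2] *ᵥ e P)
    (hσw : ∀ P : W.geomTorsion (5 : ℕ), e (σw • P) = !![0, 4; 1, 0] *ᵥ e P)
    (hrank : Nat.card {d : ClassGroup (𝓞 ↥(fixedField (Subgroup.zpowers (absRestrictNormalHom (W.divisionField 5) σu)))) // d ^ 5 = 1} =
      Nat.card {d : ClassGroup (𝓞 ↥(fixedField (Subgroup.zpowers (absRestrictNormalHom (W.divisionField 5) (σw ^ 2)) ⊔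
        Subgroup.zpowers (absRestrictNormalHom (W.divisionField 5) σu)))) // d ^ 5 = 1})
    (hcI : ∀ (𝔮 : Ideal (𝓞 ↥(W.divisionField 5))) [𝔮.IsMaximal], ((5 : ℕ) : 𝓞 ↥(W.divisionField 5)) ∈ 𝔮 →
      absRestrictNormalHom (W.divisionField 5) (σw ^ 2) ∈ 𝔮.inertia _)
    (κ : ZpExtension ℚ 5) (hκ : κ.IsCyclotomic) :
    ∃ (γ : absoluteGaloisGroup ℚ) (D : W.FineSelmerDualData κ γ),
      Module.Finite ℤ_[5] (RestrictScalars ℤ_[5] (IwasawaAlgebra 5) D.X) := by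
  have hX : (!![0, 4; 1, 0] : Matrix (Fin 2) (Fin 2) (ZMod 5)) 0 1 ≠ 0 := by decide
  haveI : Fact (Nat.Prime 5) := ⟨by norm_num⟩
  have hσm : ∀ P : W.geomTorsion (5 : ℕ), e ((σw ^ 2) • P) = -e P := fun P => by
    rw [pow_two, mul_smul, hσw, hσw, Matrix.mulVec_mulVec, w_sq_eq_neg_one₈, Matrix.neg_mulVec, Matrix.one_mulVec]
  exact conjA_of_rankEq W (by norm_num) (not_five_dvd_card_gal_of_zywinaG9 W e he) e σu (σw ^ 2) σw
    (S := !![1, 0; 0, 2]) (by simp) (by simp) hσu hσm hX hσw hrank hcI κ hκ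

end RankEqualityRoad

end Literature.NumberTheory.EllipticCurves.CoatesSujatha2005

end
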